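import Literature.NumberTheory.Automorphic.ResGLnCuspidalCohomologyApexLevel
import Literature.Algebra.Lie.ChevalleyEilenbergCentralSplitting
import HarnessLib

/-!
# Clozel's cocycle (apex fact (a′)): the split centre `Z = 1 ∈ 𝔤𝔩_n(K_∞)` and the reduction of the
# BASIC condition (Borel–Wallach I 1.3)

Topic `NumberTheory/Automorphic`; namespace `Literature.NumberTheory.Automorphic.ConeDictionary` (the
vocabulary of `ResGLnConeDictionary` / `ResGLnCuspidalCohomologyApex` / `ResGLnCuspidalCohomologyApexLevel`:
the complex `gkComplexLS π S λ = C^•(𝔤, K_∞; W ⊗ (E_λ(ℂ) ⊗ ε_S))`, its cochains `Cochain π λ q`, level-fixed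
cochains `IsLevelFixed π λ 𝔫`).  Definitions with bodies and theorems; no named fact, no `sorry` (D-0026:
a brick of the proof of the apex fact `ConeDictionary.Clozel1990_exists_basic_levelFixed_cocycle`).

The apex fact asks for a cocycle which is BASIC for the split component of the centre of
`Res_{K/ℚ} GL_n`: `i_Z η = 0` for `Z = 1 ∈ 𝔤 = 𝔤𝔩_n(K_∞)` (the Lie algebra of `A_G = ℝ_{>0}`).  In print
this is the Künneth formula `H^•(𝔤, K_∞; V) = H^•(𝔪_G, K_∞; V) ⊗ Λ^•(𝔞_G^*)` for a central `𝔞_G` acting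
trivially [cite: BorelWallach2000, I §1.3] [cite: Clozel1990, p. 120 ("divisant par le terme Λ•𝔞 = H•(𝔞, ℂ)")].
Its cochain-level mechanism (the basic projector `B = 1 - α ∧ i_Z`, Cartan's identity) is the generic file
`Algebra/Lie/ChevalleyEilenbergCentralSplitting`; THIS FILE supplies the data of the `GL_n` situation and
deduces that the basic condition can be dropped from the level-fixed form of the apex fact
(`Clozel1990_exists_basic_levelFixed_cocycle_of_levelSubcomplex`, file `…ApexLevel`), in degrees `≥ 2`:

* `centerOne`, `realTrace`, `traceForm` — `Z = 1`, the real trace `X ↦ Re Tr_{K_∞/ℝ} X` and the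
  normalised trace form `α = realTrace / realTrace(Z)` (`α(Z) = 1` for `n ≥ 1`), which vanishes on
  brackets, on `𝔨` (skew-hermitian matrices have imaginary trace) and is `Ad K_∞`-invariant; `Z` is
  central and `Ad`-fixed;
* `archCoeffLie_centerOne`, `lie_centerOne_carrier` — `Z` acts on `E_λ(ℂ) ⊗ ε_S` by the scalar
  `|λ| = ∑_τ ∑_i λ_{τ,i}` (`coeffCentralWeight`: Leibniz rule on the Weyl module `S_μ(ℂⁿ) ⊆ (ℂⁿ)^{⊗d}`,
  `d = ∑ᵢ (λᵢ - λ_{n-1})`, plus `λ_{n-1} · tr`), hence on the carrier `W ⊗ E` by `μ + |λ|` when it acts on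
  `W` by `μ` [cite: BorelWallach2000, 0 §2.3, I §1.3];
* `levelTranslateHom`, `isLevelFixed_iff_map`, `IsLevelFixed.sub/smul/ins/d/wedgeOne` — level-fixedness is
  invariance under the cochain maps `(r(u) ⊗ 1)_*`, `u ∈ K_f(𝔫)`, hence stable under the operations of the
  complex [cite: BorelWallach2000, I §5.1];
* `pairActionLS`, `gkComplexLS_eq_gK` — the complex in the generic form `C^•(𝔤, 𝔨; W ⊗ E)^{K_∞}`;
* `exists_basic_of_isLevelFixed` — **from a level-fixed cocycle `η` of degree `q + 2` which is not a
  level-fixed coboundary, a BASIC one in degree `q + 2` (`B η`) or `q + 1` (`i_Z η`)** (the generic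
  `exists_basic_of_not_coboundary`; Cartan forces `μ + |λ| = 0` [cite: BorelWallach2000, I §1.1 (5)]);
* `Clozel1990_exists_basic_levelFixed_cocycle_of_cohomology_two` — hence **the apex fact follows from:
  for every clean cohomological cuspidal `π` with a `K(𝔫)`-fixed vector there are `S` and a level-fixed
  cocycle of some degree `q + 2 ≥ 2` of `gkComplexLS π.1 S λ` which is not the coboundary of a level-fixed
  cochain** — non-vanishing of `H^{≥ 2}` of the complex of `W^{K(𝔫)} ⊗ (E_λ ⊗ ε_S)`, with no basic
  condition; this is what Clozel's Lemme 3.14 delivers (bottom degree `∑_v d_v ≥ 1`, and one more from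
  `Λ•(𝔷 ∩ 𝔭)^*`) [cite: Clozel1990, Lemme 3.14 (p. 114) and §3.5 (pp. 120–123)].

## References

* A. Borel, N. Wallach, *Continuous cohomology, discrete subgroups, and representations of reductive
  groups*, 2nd ed. (2000), 0 §2.3, I §1.1 (5), I §1.3, I §5.1. [BorelWallach2000]
* L. Clozel, *Motifs et formes automorphes: applications du principe de fonctorialité* (Ann Arbor 1988),
  Perspect. Math. 10 (1990), Lemme 3.14 (p. 114), p. 120, §3.5. [Clozel1990]
-/

noncomputable section

open scoped Classical TensorProduct Matrix
open NumberField IsDedekindDomain NumberField.InfinitePlace NumberField.mixedEmbedding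

namespace Literature.NumberTheory.Automorphic

-- Mathlib idiom (as in `GKModules` and the whole cone dictionary): commutator bracket on matrix algebras
attribute [local instance 100] LieRing.ofAssociativeRing

namespace ConeDictionary

open ResGLnCohomology BigHeckeGLn RealMatrixGroup Literature.Algebra.Lie.ChevalleyEilenberg

variable {n : ℕ} {K : Type} [Field K] [NumberField K] {hcpt : isCompact_glFiniteIntegralLevel n K}
  (π : AutomorphicRepData (AutomorphyDatum.gl n K hcpt))
  (S : Finset {w : InfinitePlace K // w.IsReal}) (lam : (K →+* ℂ) → Fin n → ℤ)

/-! ### `Z = 1`, the real trace and the trace form `α` -/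

section TraceForm

variable (n K hcpt)

/-- **`Z = 1 ∈ 𝔤 = 𝔤𝔩_n(K_∞)`**, the generator of the Lie algebra of the split component `A_G = ℝ_{>0}`
of the centre of `Res_{K/ℚ} GL_n`. [cite: BorelWallach2000, I §1.3] -/
def centerOne : (AutomorphyDatum.gl n K hcpt).arch.lie :=
  ⟨1, trivial⟩

/-- As a matrix, `Z = 1`. [folklore] -/
@[simp] theorem coe_centerOne :
    ((centerOne n K hcpt : (AutomorphyDatum.gl n K hcpt).arch.lie) : Matrix (Fin n) (Fin n) (mixedSpace K)) = 1 :=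
  rfl

/-- The real-part functional `x ↦ ∑_{w real} x_w + ∑_{w complex} Re x_w` on `K_∞ = ℝ^{r₁} × ℂ^{r₂}`
(i.e. `½ Tr_{K_∞/ℝ}` on the complex factors, `Tr` on the real ones). [folklore] -/
def realPart : mixedSpace K →ₗ[ℝ] ℝ :=
  (∑ w : {w : InfinitePlace K // w.IsReal}, (LinearMap.proj w : ({w : InfinitePlace K // w.IsReal} → ℝ) →ₗ[ℝ] ℝ)) ∘ₗ
      LinearMap.fst ℝ _ _ +
    (∑ w : {w : InfinitePlace K // w.IsComplex},
        Complex.reLm ∘ₗ (LinearMap.proj w : ({w : InfinitePlace K // w.IsComplex} → ℂ) →ₗ[ℝ] ℂ)) ∘ₗ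
      LinearMap.snd ℝ _ _

/-- Unfolding. [folklore] -/
theorem realPart_apply (x : mixedSpace K) : realPart K x = ∑ w, x.1 w + ∑ w, (x.2 w).re := by
  simp [realPart]

/-- **The real trace** `X ↦ realPart (tr X)` on `𝔤 = 𝔤𝔩_n(K_∞)`. [folklore] -/
def realTrace : (AutomorphyDatum.gl n K hcpt).arch.lie →ₗ[ℝ] ℝ :=
  realPart K ∘ₗ Matrix.traceLinearMap (Fin n) ℝ (mixedSpace K) ∘ₗ
    (AutomorphyDatum.gl n K hcpt).arch.lie.incl.toLinearMap

/-- Unfolding. [folklore] -/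
theorem realTrace_apply (X : (AutomorphyDatum.gl n K hcpt).arch.lie) :
    realTrace n K hcpt X = realPart K (Matrix.trace (X : Matrix (Fin n) (Fin n) (mixedSpace K))) :=
  rfl

/-- `realTrace Z = n (r₁ + r₂)`. [folklore] -/
theorem realTrace_centerOne :
    realTrace n K hcpt (centerOne n K hcpt) = n * (nrRealPlaces K + nrComplexPlaces K : ℕ) := by
  rw [realTrace_apply, coe_centerOne, Matrix.trace_one, Fintype.card_fin, realPart_apply]
  simp only [Prod.fst_natCast, Prod.snd_natCast, Pi.natCast_apply, Complex.natCast_re, Finset.sum_const,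
    Finset.card_univ, Nat.cast_add]
  ring

/-- `realTrace Z ≠ 0` for `n ≥ 1` (a number field has an infinite place). [folklore] -/
theorem realTrace_centerOne_ne_zero (hn : 1 ≤ n) : realTrace n K hcpt (centerOne n K hcpt) ≠ 0 := by
  rw [realTrace_centerOne, ← card_eq_nrRealPlaces_add_nrComplexPlaces]
  have h1 : (0 : ℝ) < n := by exact_mod_cast hn
  have h2 : (0 : ℝ) < (Fintype.card (InfinitePlace K) : ℕ) := by
    obtain ⟨σ⟩ : Nonempty (K →+* ℂ) := inferInstance
    exact_mod_cast Fintype.card_pos_iff.2 ⟨InfinitePlace.mk σ⟩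
  exact (mul_pos h1 h2).ne'

/-- The real trace vanishes on brackets (`tr (XY - YX) = 0`). [folklore] -/
theorem realTrace_lie (X Y : (AutomorphyDatum.gl n K hcpt).arch.lie) : realTrace n K hcpt ⁅X, Y⁆ = 0 := by
  rw [realTrace_apply, LieSubalgebra.coe_bracket, Ring.lie_def, Matrix.trace_sub, Matrix.trace_mul_comm,
    sub_self, map_zero]

/-- The real trace is `Ad`-invariant (`tr (g X g⁻¹) = tr X`). [folklore] -/
theorem realTrace_Ad (g : (AutomorphyDatum.gl n K hcpt).arch.carrier) (X : (AutomorphyDatum.gl n K hcpt).arch.lie) :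
    realTrace n K hcpt ((AutomorphyDatum.gl n K hcpt).arch.Ad g X) = realTrace n K hcpt X := by
  rw [realTrace_apply, realTrace_apply, RealMatrixGroup.Ad_apply_coe, Matrix.trace_mul_cycle,
    ← Units.val_mul, inv_mul_cancel, Units.val_one, Matrix.one_mul]

/-- The real trace vanishes on skew-hermitian matrices (their trace `t` satisfies `star t = -t`, so its
real components and the real parts of its complex components vanish). [folklore] -/
theorem realTrace_eq_zero_of_skew (X : (AutomorphyDatum.gl n K hcpt).arch.lie)
    (hX : star (X : Matrix (Fin n) (Fin n) (mixedSpace K)) = -(X : Matrix (Fin n) (Fin n) (mixedSpace K))) :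
    realTrace n K hcpt X = 0 := by
  set t : mixedSpace K := Matrix.trace (X : Matrix (Fin n) (Fin n) (mixedSpace K)) with ht
  have hstar : star t = -t := by
    rw [ht, ← Matrix.trace_conjTranspose, ← Matrix.star_eq_conjTranspose, hX, Matrix.trace_neg]
  have h1 : ∀ w, t.1 w = 0 := fun w => by
    have e := congrArg (fun s : mixedSpace K => s.1 w) hstar
    simp only [Prod.fst_star, Pi.star_apply, star_trivial, Prod.fst_neg, Pi.neg_apply] at e
    linarith
  have h2 : ∀ w, (t.2 w).re = 0 := fun w => by
    have e := congrArg (fun s : mixedSpace K => (s.2 w).re) hstar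
    simp only [Prod.snd_star, Pi.star_apply, Complex.star_def, Complex.conj_re, Prod.snd_neg, Pi.neg_apply,
      Complex.neg_re] at e
    linarith
  rw [realTrace_apply, ← ht, realPart_apply]
  simp [h1, h2]

/-- **The trace form `α = realTrace / realTrace(Z)`** on `𝔤` (so that `α(Z) = 1` for `n ≥ 1`).
[cite: BorelWallach2000, I §1.3] -/
def traceForm : (AutomorphyDatum.gl n K hcpt).arch.lie →ₗ[ℝ] ℝ :=
  (realTrace n K hcpt (centerOne n K hcpt))⁻¹ • realTrace n K hcpt

/-- Unfolding. [folklore] -/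
theorem traceForm_apply (X : (AutomorphyDatum.gl n K hcpt).arch.lie) :
    traceForm n K hcpt X = (realTrace n K hcpt (centerOne n K hcpt))⁻¹ * realTrace n K hcpt X :=
  rfl

/-- `α(Z) = 1` for `n ≥ 1`. [cite: BorelWallach2000, I §1.3] -/
theorem traceForm_centerOne (hn : 1 ≤ n) : traceForm n K hcpt (centerOne n K hcpt) = 1 := by
  rw [traceForm_apply, inv_mul_cancel₀ (realTrace_centerOne_ne_zero n K hcpt hn)]

/-- `α` vanishes on brackets. [folklore] -/
theorem traceForm_lie (X Y : (AutomorphyDatum.gl n K hcpt).arch.lie) : traceForm n K hcpt ⁅X, Y⁆ = 0 := by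
  rw [traceForm_apply, realTrace_lie, mul_zero]

/-- `α` is `Ad`-invariant. [folklore] -/
theorem traceForm_Ad (g : (AutomorphyDatum.gl n K hcpt).arch.carrier) (X : (AutomorphyDatum.gl n K hcpt).arch.lie) :
    traceForm n K hcpt ((AutomorphyDatum.gl n K hcpt).arch.Ad g X) = traceForm n K hcpt X := by
  rw [traceForm_apply, traceForm_apply, realTrace_Ad]

/-- `α` vanishes on `𝔨` (skew-hermitian elements of `𝔤`). [folklore] -/
theorem traceForm_eq_zero_of_mem_kInLie (X : (AutomorphyDatum.gl n K hcpt).arch.lie)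
    (hX : X ∈ (AutomorphyDatum.gl n K hcpt).arch.kInLie) : traceForm n K hcpt X = 0 := by
  have hsk := (((AutomorphyDatum.gl n K hcpt).arch.mem_compactLie_iff _).1
    (((AutomorphyDatum.gl n K hcpt).arch.mem_kInLie_iff X).1 hX)).2
  rw [traceForm_apply, realTrace_eq_zero_of_skew n K hcpt X hsk, mul_zero]

/-- `Z` is central in `𝔤`. [folklore] -/
theorem centerOne_lie (X : (AutomorphyDatum.gl n K hcpt).arch.lie) : ⁅centerOne n K hcpt, X⁆ = 0 := by
  ext : 1
  rw [LieSubalgebra.coe_bracket, Ring.lie_def, coe_centerOne, Matrix.one_mul, Matrix.mul_one, sub_self]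
  rfl

/-- `Z` is `Ad`-fixed. [folklore] -/
theorem Ad_centerOne (g : (AutomorphyDatum.gl n K hcpt).arch.carrier) :
    (AutomorphyDatum.gl n K hcpt).arch.Ad g (centerOne n K hcpt) = centerOne n K hcpt := by
  ext : 1
  rw [RealMatrixGroup.Ad_apply_coe, coe_centerOne, Matrix.mul_one, ← Units.val_mul, mul_inv_cancel,
    Units.val_one]

end TraceForm

/-! ### `Z` acts on `E_λ(ℂ)` by `|λ|`, on the carrier `W ⊗ E` by `μ + |λ|` -/

section CoeffScalar

variable (n K) in
/-- **`|λ| = ∑_τ (d_τ + n λ_{τ,n-1})`** with `d_τ = ∑ᵢ (λ_{τ,i} - λ_{τ,n-1})` (`coeffDegree`) and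
`λ_{τ,n-1}` the lowest entry — the scalar by which `Z = 1` acts on `E_λ(ℂ) = ⨂_τ (S_{μ_τ}(ℂⁿ) ⊗ det^{λ_{τ,n-1}})`;
for dominant `λ_τ` this is `∑_{τ,i} λ_{τ,i}`. [cite: BorelWallach2000, 0 §2.3] -/
def coeffCentralWeight (lam : (K →+* ℂ) → Fin n → ℤ) : ℂ :=
  ∑ τ : K →+* ℂ, ((GLnCohomology.coeffDegree (lam τ) : ℂ) + n * (GLnCohomology.lowestEntry (lam τ) : ℂ))

/-- `Z` acts trivially (as the identity) on the `τ̃`-standard module `ℂⁿ`. [folklore] -/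
theorem phiStdLie_centerOne (τ : K →+* ℂ) (v : Fin n → ℂ) :
    phiStdLie (AutomorphyDatum.gl n K hcpt).arch (embeddingExt τ) (centerOne n K hcpt) v = v := by
  rw [phiStdLie_apply, coe_centerOne, Matrix.map_one _ (map_zero _) (map_one _), Matrix.one_mulVec]

/-- `Z` acts on `(ℂⁿ)^{⊗d}` by `d` (Leibniz rule). [cite: BorelWallach2000, 0 §2.3] -/
theorem stdPowLie_centerOne (τ : K →+* ℂ) (d : ℕ) (t : TensorPower ℂ d (Fin n → ℂ)) :
    ParallelWeight.stdPowLie K n τ d (centerOne n K hcpt) t = (d : ℂ) • t := by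
  induction t using PiTensorProduct.induction_on with
  | smul_tprod r f =>
    rw [map_smul, ParallelWeight.stdPowLie, PiTensor.piLie_tprod]
    have hup : ∀ i : Fin d, Function.update f i
        (phiStdLie (archGroupGL n K) (embeddingExt τ) (centerOne n K hcpt) (f i)) = f := fun i => by
      rw [show phiStdLie (archGroupGL n K) (embeddingExt τ) (centerOne n K hcpt) (f i) = f i from
        phiStdLie_centerOne τ (f i), Function.update_eq_self]
    simp only [hup, Finset.sum_const, Finset.card_univ, Fintype.card_fin]
    rw [smul_comm, ← Nat.cast_smul_eq_nsmul ℂ]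
  | add x y hx hy => rw [map_add, hx, hy, smul_add]

/-- **`Z` acts on `V_{λ_τ}(ℂ)` by `d_τ + n λ_{τ,n-1}`.** [cite: BorelWallach2000, 0 §2.3] -/
theorem factorLie_centerOne (τ : K →+* ℂ) (w : GLnCohomology.CoeffModule ℂ n (lam τ)) :
    ParallelWeight.factorLie K n (lam τ) τ (centerOne n K hcpt) w =
      ((GLnCohomology.coeffDegree (lam τ) : ℂ) + n * (GLnCohomology.lowestEntry (lam τ) : ℂ)) • w := by
  rw [ParallelWeight.factorLie, twistLie_apply, detCharLie_apply, coe_centerOne,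
    Matrix.map_one _ (map_zero _) (map_one _), Matrix.trace_one, Fintype.card_fin, add_smul]
  congr 1
  · -- the Weyl-module part: `Z` acts on `S_μ(ℂⁿ) ⊆ (ℂⁿ)^{⊗d}` by `d`
    exact Subtype.ext (stdPowLie_centerOne (hcpt := hcpt) τ (GLnCohomology.coeffDegree (lam τ)) _)
  · rw [mul_comm]

set_option maxHeartbeats 400000 in
-- `σ𝔤S` is an abbrev tower over the datum
/-- **`Z` acts on `E_λ(ℂ) ⊗ ε_S` by the scalar `|λ|`** (`coeffCentralWeight`; the sign character has
trivial differential). [cite: BorelWallach2000, 0 §2.3] -/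
theorem archCoeffLie_centerOne (v : ResGLnCohomology.CoeffModule ℂ n K lam) :
    σ𝔤S hcpt lam (centerOne n K hcpt) v = coeffCentralWeight n K lam • v := by
  change ResGLnCohomology.archCoeffLie n K lam (centerOne n K hcpt) v = _
  induction v using ResGLnCohomology.CoeffModule.induction_on with
  | smul_tprod r f =>
    rw [map_smul, ResGLnCohomology.CoeffModule.tprod, ResGLnCohomology.archCoeffLie]
    change r • PiTensor.piLie (archGroupGL n K) (fun τ => ParallelWeight.factorLie K n (lam τ) τ)
      (centerOne n K hcpt) (PiTensorProduct.tprod ℂ f) = _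
    rw [PiTensor.piLie_tprod]
    have hup : ∀ τ : K →+* ℂ, PiTensorProduct.tprod ℂ (Function.update f τ
        (ParallelWeight.factorLie K n (lam τ) τ (centerOne n K hcpt) (f τ))) =
        ((GLnCohomology.coeffDegree (lam τ) : ℂ) + n * (GLnCohomology.lowestEntry (lam τ) : ℂ)) •
          PiTensorProduct.tprod ℂ f := fun τ => by
      rw [factorLie_centerOne, MultilinearMap.map_update_smul, Function.update_eq_self]
    simp only [hup]
    rw [← Finset.sum_smul, smul_comm]
    rfl
  | add x y hx hy => rw [map_add, hx, hy, smul_add]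

end CoeffScalar

/-! ### The action of `Z` on the carrier `W ⊗ E` -/

section Carrier

variable {π lam}

/-- The bracket of the `𝔤`-module `W ⊗ E` is the Leibniz action (unfolding). [folklore] -/
theorem bracket_carrier (X : (AutomorphyDatum.gl n K hcpt).arch.lie) (t : Carrier π lam) :
    ⁅X, t⁆ = GKTensor.lie (AutomorphyDatum.gl n K hcpt).arch π.lieRepW (σ𝔤S hcpt lam) X
      (@id (π.W ⊗[ℂ] ResGLnCohomology.CoeffModule ℂ n K lam) t) :=
  rfl

/-- **`Z` acts on the carrier `W ⊗ E` by the scalar `μ + |λ|`** when it acts on `W` by `μ`.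
[cite: BorelWallach2000, I §1.3] -/
theorem lie_centerOne_carrier {μ : ℂ}
    (hμ : ∀ c ∈ π.W, lieDeriv (AutomorphyDatum.gl n K hcpt).ofArch (centerOne n K hcpt) c = μ • c)
    (t : Carrier π lam) :
    ⁅centerOne n K hcpt, t⁆ = (μ + coeffCentralWeight n K lam) • t := by
  have hW : π.lieRepW (centerOne n K hcpt) = μ • LinearMap.id :=
    LinearMap.ext fun φ => Subtype.ext (hμ φ φ.2)
  have hE : σ𝔤S hcpt lam (centerOne n K hcpt) = coeffCentralWeight n K lam • LinearMap.id :=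
    LinearMap.ext (archCoeffLie_centerOne lam)
  have key : GKTensor.lie (AutomorphyDatum.gl n K hcpt).arch π.lieRepW (σ𝔤S hcpt lam) (centerOne n K hcpt) =
      (μ + coeffCentralWeight n K lam) • LinearMap.id := by
    rw [GKTensor.lie_apply, hW, hE, LinearMap.rTensor_smul, LinearMap.lTensor_smul, LinearMap.rTensor_id,
      LinearMap.lTensor_id, add_smul]
  rw [bracket_carrier, key]
  rfl

end Carrier

/-! ### Level-fixed cochains: closure properties -/

section LevelFixed

variable {π lam}

/-- Right translations `r(u) ⊗ 1`, `u ∈ GL_n(𝔸_K^∞)`, commute with the Leibniz action of `𝔤` on `W ⊗ E`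
(`G_∞` and `G(𝔸_f)` commute). [cite: BorelWallach2000, I §5.1] -/
theorem rTensor_finiteRepW_comp_lie (u : (AutomorphyDatum.gl n K hcpt).finiteAdelic)
    (X : (AutomorphyDatum.gl n K hcpt).arch.lie) :
    (π.finiteRepW u).rTensor (ResGLnCohomology.CoeffModule ℂ n K lam) ∘ₗ
        GKTensor.lie (AutomorphyDatum.gl n K hcpt).arch π.lieRepW (σ𝔤S hcpt lam) X =
      GKTensor.lie (AutomorphyDatum.gl n K hcpt).arch π.lieRepW (σ𝔤S hcpt lam) X ∘ₗ
        (π.finiteRepW u).rTensor (ResGLnCohomology.CoeffModule ℂ n K lam) := by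
  rw [GKTensor.lie_apply, LinearMap.comp_add, LinearMap.add_comp, ← LinearMap.rTensor_comp,
    ← lieRepW_comp_finiteRepW π X, LinearMap.rTensor_comp, LinearMap.rTensor_comp_lTensor,
    LinearMap.lTensor_comp_rTensor]

variable (π lam) in
/-- Right translation by `u ∈ GL_n(𝔸_K^∞)` on the carrier `W ⊗ E`, as an endomorphism of the `𝔤`-module.
[cite: BorelWallach2000, I §5.1] -/
def levelTranslateHom (u : (AutomorphyDatum.gl n K hcpt).finiteAdelic) :
    Carrier π lam →ₗ⁅ℝ,(AutomorphyDatum.gl n K hcpt).arch.lie⁆ Carrier π lam :=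
  GKCarrier.hom (AutomorphyDatum.gl n K hcpt).arch
    (GKTensor.lie (AutomorphyDatum.gl n K hcpt).arch π.lieRepW (σ𝔤S hcpt lam))
    (GKTensor.lie (AutomorphyDatum.gl n K hcpt).arch π.lieRepW (σ𝔤S hcpt lam))
    ((π.finiteRepW u).rTensor (ResGLnCohomology.CoeffModule ℂ n K lam)) (rTensor_finiteRepW_comp_lie u)

/-- Unfolding. [folklore] -/
theorem levelTranslateHom_apply (u : (AutomorphyDatum.gl n K hcpt).finiteAdelic) (t : Carrier π lam) :
    @id (π.W ⊗[ℂ] ResGLnCohomology.CoeffModule ℂ n K lam) (levelTranslateHom π lam u t) =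
      (π.finiteRepW u).rTensor (ResGLnCohomology.CoeffModule ℂ n K lam)
        (@id (π.W ⊗[ℂ] ResGLnCohomology.CoeffModule ℂ n K lam) t) :=
  rfl

/-- `r(u) ⊗ 1` is `ℂ`-linear on the carrier. [folklore] -/
theorem levelTranslateHom_smul (u : (AutomorphyDatum.gl n K hcpt).finiteAdelic) (a : ℂ) (t : Carrier π lam) :
    levelTranslateHom π lam u (a • t) = a • levelTranslateHom π lam u t :=
  ((π.finiteRepW u).rTensor (ResGLnCohomology.CoeffModule ℂ n K lam)).map_smul a
    (@id (π.W ⊗[ℂ] ResGLnCohomology.CoeffModule ℂ n K lam) t)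

/-- **Level-fixedness through the cochain maps `(r(u) ⊗ 1)_*`**: `η` is level-fixed iff
`(r(u) ⊗ 1) ∘ η = η` for all `u ∈ K_f(𝔫)`. [folklore] -/
theorem isLevelFixed_iff_map {𝔫 : Ideal (𝓞 K)} {q : ℕ} (f : Cochain π lam q) :
    IsLevelFixed π lam 𝔫 f ↔ ∀ u ∈ ResGLnCohomology.level n K 𝔫,
      map (AutomorphyDatum.gl n K hcpt).arch.lie (levelTranslateHom π lam ⟨GLn.ofFinite n K u, u, rfl⟩) q f = f := by
  constructor
  · intro h u hu
    exact AlternatingMap.ext fun w => h w u hu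
  · intro h w u hu
    exact congrArg (fun g : Cochain π lam q => g w) (h u hu)

variable {𝔫 : Ideal (𝓞 K)}

/-- Level-fixed cochains are stable under sums. [folklore] -/
theorem IsLevelFixed.add {q : ℕ} {f g : Cochain π lam q} (hf : IsLevelFixed π lam 𝔫 f) (hg : IsLevelFixed π lam 𝔫 g) :
    IsLevelFixed π lam 𝔫 (f + g) := by
  rw [isLevelFixed_iff_map] at hf hg ⊢
  intro u hu
  rw [map_add, hf u hu, hg u hu]

/-- Level-fixed cochains are stable under differences. [folklore] -/
theorem IsLevelFixed.sub {q : ℕ} {f g : Cochain π lam q} (hf : IsLevelFixed π lam 𝔫 f) (hg : IsLevelFixed π lam 𝔫 g) :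
    IsLevelFixed π lam 𝔫 (f - g) := by
  rw [isLevelFixed_iff_map] at hf hg ⊢
  intro u hu
  rw [map_sub, hf u hu, hg u hu]

/-- Level-fixed cochains are stable under the complex scalars. [folklore] -/
theorem IsLevelFixed.smul {q : ℕ} {f : Cochain π lam q} (hf : IsLevelFixed π lam 𝔫 f) (a : ℂ) :
    IsLevelFixed π lam 𝔫 (a • f) := by
  rw [isLevelFixed_iff_map] at hf ⊢
  intro u hu
  conv_rhs => rw [← hf u hu]
  exact AlternatingMap.ext fun w => levelTranslateHom_smul _ a (f w)

/-- Insertions of level-fixed cochains are level-fixed. [folklore] -/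
theorem IsLevelFixed.ins {q : ℕ} {f : Cochain π lam (q + 1)} (hf : IsLevelFixed π lam 𝔫 f)
    (x : (AutomorphyDatum.gl n K hcpt).arch.lie) : IsLevelFixed π lam 𝔫 (ins q x f) :=
  fun _ u hu => hf _ u hu

/-- **The differential of a level-fixed cochain is level-fixed** (`d` commutes with the cochain maps
`(r(u) ⊗ 1)_*`). [folklore] -/
theorem IsLevelFixed.d {q : ℕ} {f : Cochain π lam q} (hf : IsLevelFixed π lam 𝔫 f) :
    IsLevelFixed π lam 𝔫 (d ℝ (AutomorphyDatum.gl n K hcpt).arch.lie (Carrier π lam) q f) := by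
  rw [isLevelFixed_iff_map] at hf ⊢
  intro u hu
  rw [← d_map, hf u hu]

/-- The wedge of a level-fixed cochain with a scalar `1`-form is level-fixed. [folklore] -/
theorem IsLevelFixed.wedgeOne (α : (AutomorphyDatum.gl n K hcpt).arch.lie →ₗ[ℝ] ℝ) {q : ℕ} {f : Cochain π lam q}
    (hf : IsLevelFixed π lam 𝔫 f) : IsLevelFixed π lam 𝔫 (wedgeOne (Carrier π lam) α q f) := by
  rw [isLevelFixed_iff_map] at hf ⊢
  intro u hu
  rw [map_wedgeOne, hf u hu]

end LevelFixed

/-! ### The `(𝔤, K_∞)`-complex in generic form -/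

section Generic

/-- The pair action `(Ad, (r ⊗ (E ⊗ ε_S))|_{K_∞})` of `K_∞` on `(𝔤, W ⊗ E)` defining the complex
`gkComplexLS π S λ`. [cite: BorelWallach2000, I §5.1 (1)] -/
abbrev pairActionLS :
    PairAction ℝ (AutomorphyDatum.gl n K hcpt).arch.lie (Carrier π lam) (AutomorphyDatum.gl n K hcpt).arch.maximalCompact :=
  gkPairAction (AutomorphyDatum.gl n K hcpt).arch (π.kRepW.tprod (σSK hcpt S lam))
    (GKTensor.lie (AutomorphyDatum.gl n K hcpt).arch π.lieRepW (σ𝔤S hcpt lam))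
    (GKTensor.ad_compat (AutomorphyDatum.gl n K hcpt).arch π.kRepW π.lieRepW (σSK hcpt S lam) (σ𝔤S hcpt lam)
      π.kRepW_lieRepW_ad_compat (σS_ad_compat S lam))

/-- `gkComplexLS π S λ` is the `(𝔤, K_∞)`-complex `C^•(𝔤, 𝔨; W ⊗ E)^{K_∞}` of that pair action
(definitional unfolding, used to apply the generic relative Chevalley–Eilenberg lemmas). [folklore] -/
theorem gkComplexLS_eq_gK :
    gkComplexLS π S lam = Subcomplex.gK ℝ (AutomorphyDatum.gl n K hcpt).arch.lie (Carrier π lam)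
      (AutomorphyDatum.gl n K hcpt).arch.kInLie (pairActionLS π S lam) :=
  rfl

/-- `Z` is fixed by the pair action (`Ad k Z = Z`). [folklore] -/
theorem pairActionLS_σ_centerOne (k : (AutomorphyDatum.gl n K hcpt).arch.maximalCompact) :
    (pairActionLS π S lam).σ k (centerOne n K hcpt) = centerOne n K hcpt :=
  Ad_centerOne n K hcpt _

/-- The trace form is invariant under the pair action (`α ∘ Ad k = α`). [folklore] -/
theorem traceForm_pairActionLS_σ (k : (AutomorphyDatum.gl n K hcpt).arch.maximalCompact)
    (X : (AutomorphyDatum.gl n K hcpt).arch.lie) :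
    traceForm n K hcpt ((pairActionLS π S lam).σ k X) = traceForm n K hcpt X :=
  traceForm_Ad n K hcpt _ X

end Generic

/-! ### From a level-fixed class in degree `q + 2` to a BASIC level-fixed class -/

section Main

variable {lam}

/-- **The basic reduction for `gkComplexLS π S λ`.**  Let `Z` act on `W` by a scalar (`hμ`) and let `η` be a
level-fixed cocycle of degree `q + 2` which is not the coboundary of a level-fixed cochain of the complex.
Then there is a BASIC level-fixed cocycle (`i_Z η' = 0`), of degree `q + 2` (`B η`) or `q + 1` (`i_Z η`),
which is not the coboundary of a level-fixed cochain of the complex (the generic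
`ChevalleyEilenberg.exists_basic_of_not_coboundary` for `z = Z`, `α` the trace form, scalars `ℂ`, `c = μ + |λ|`
and the property "level-fixed"). [cite: BorelWallach2000, I §1.3] [cite: Clozel1990, p. 120] -/
theorem exists_basic_of_isLevelFixed {𝔫 : Ideal (𝓞 K)} (hn : 1 ≤ n) {μ : ℂ}
    (hμ : ∀ c ∈ π.W, lieDeriv (AutomorphyDatum.gl n K hcpt).ofArch (centerOne n K hcpt) c = μ • c)
    {q : ℕ} {η : Cochain π lam (q + 2)} (hηZ : η ∈ (gkComplexLS π S lam).cocycles (q + 2))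
    (hfix : IsLevelFixed π lam 𝔫 η)
    (hne : ∀ β ∈ (gkComplexLS π S lam).carrier (q + 1), IsLevelFixed π lam 𝔫 β →
      d ℝ (AutomorphyDatum.gl n K hcpt).arch.lie (Carrier π lam) (q + 1) β ≠ η) :
    ∃ (q' : ℕ) (η' : Cochain π lam (q' + 1)),
      η' ∈ (gkComplexLS π S lam).cocycles (q' + 1) ∧ IsLevelFixed π lam 𝔫 η' ∧
        ins q' (centerOne n K hcpt) η' = 0 ∧
          ∀ β ∈ (gkComplexLS π S lam).carrier q', IsLevelFixed π lam 𝔫 β →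
            d ℝ (AutomorphyDatum.gl n K hcpt).arch.lie (Carrier π lam) q' β ≠ η' := by
  rw [gkComplexLS_eq_gK] at hηZ hne ⊢
  have h := exists_basic_of_not_coboundary (traceForm n K hcpt) (centerOne n K hcpt)
    (AutomorphyDatum.gl n K hcpt).arch.kInLie (pairActionLS π S lam)
    (fun x hx => traceForm_eq_zero_of_mem_kInLie n K hcpt x hx) (traceForm_lie n K hcpt)
    (traceForm_pairActionLS_σ π S lam) (centerOne_lie n K hcpt) (pairActionLS_σ_centerOne π S lam)
    (traceForm_centerOne n K hcpt hn) (lie_centerOne_carrier hμ)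
    (fun (q : ℕ) (f : Cochain π lam q) => IsLevelFixed π lam 𝔫 f)
    (fun _ _ _ hf hg => hf.sub hg) (fun _ a _ hf => hf.smul a) (fun _ _ hf => hf.ins _)
    (fun _ _ hf => hf.wedgeOne _) hηZ hfix hne
  obtain ⟨q', η', h1, h2, h3, h4⟩ := h
  exact ⟨q', η', h1, h2, h3, h4⟩

open Literature.NumberTheory.DiophantineGeometry Literature.Barriers.Langlands in
/-- **The apex fact follows from non-vanishing in degree `≥ 2` of the level-fixed complex, WITHOUT the basic
condition**: it suffices to produce, for every `n ≥ 2`, `𝔫 ≠ 0`, dominant `λ` and clean cohomological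
cuspidal `π` with a `K(𝔫)`-fixed vector, a set `S` of real places and a level-fixed cocycle
`η ∈ C^{q+2}(𝔤, K_∞; W ⊗ (E_λ ⊗ ε_S))` (any `q`) which is not the coboundary of a level-fixed cochain of the
complex — i.e. a non-zero class of degree `≥ 2` of the `(𝔤, K_∞)`-complex of `W^{K(𝔫)} ⊗ (E_λ ⊗ ε_S)`.
(Clozel's Lemme 3.14 gives classes in all degrees from `∑_v d_v ≥ 1` to `∑_v d_v + dim (𝔷 ∩ 𝔭)`, so
degree `≥ 2` is attained.) [cite: Clozel1990, Lemme 3.14 (p. 114) and §3.5 (pp. 120–123)]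
[cite: BorelWallach2000, I §1.3 and I §5.1] -/
theorem Clozel1990_exists_basic_levelFixed_cocycle_of_cohomology_two
    (H : ∀ (n : ℕ) (K : Type) [Field K] [NumberField K] (hcpt : isCompact_glFiniteIntegralLevel n K)
      (𝔫 : Ideal (𝓞 K)) (lam : (K →+* ℂ) → Fin n → ℤ), 2 ≤ n → 𝔫 ≠ 0 →
      (∀ τ, Weight.IsDominant (lam τ)) →
      ∀ π : CuspidalAutomorphicRepData n K hcpt, π.1.W' = ⊥ →
        (∃ μ : ℂ, ∀ c ∈ π.1.W, lieDeriv (AutomorphyDatum.gl n K hcpt).ofArch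
          (⟨1, trivial⟩ : (AutomorphyDatum.gl n K hcpt).arch.lie) c = μ • c) →
        (∃ T : InfinityType K n, π.1.HasInfinityType T ∧
          ∀ τ : K →+* ℂ, (T τ).map ArchWeight.a =
            (cohomologicalInfinityType n K (Weight.dual (lam τ)) τ).map ArchWeight.a) →
        (∃ φ ∈ π.1.W, φ ≠ 0 ∧
          ∀ u ∈ principalCongruenceLevel n K 𝔫, rightTranslation (AdelicGroupData.gl n K) u φ = φ) →
        ∃ (S : Finset {w : InfinitePlace K // w.IsReal}) (q : ℕ) (η : Cochain π.1 lam (q + 2)),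
          η ∈ (gkComplexLS π.1 S lam).cocycles (q + 2) ∧
            IsLevelFixed π.1 lam 𝔫 η ∧
              ∀ β ∈ (gkComplexLS π.1 S lam).carrier (q + 1), IsLevelFixed π.1 lam 𝔫 β →
                Literature.Algebra.Lie.ChevalleyEilenberg.d ℝ (AutomorphyDatum.gl n K hcpt).arch.lie
                  (Carrier π.1 lam) (q + 1) β ≠ η) :
    Clozel1990_exists_basic_levelFixed_cocycle := by
  refine Clozel1990_exists_basic_levelFixed_cocycle_of_levelSubcomplex ?_
  intro n K _ _ hcpt 𝔫 lam hn h𝔫 hdom π hW' hμ hT hφ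
  obtain ⟨S, q, η, hηZ, hfix, hne⟩ := H n K hcpt 𝔫 lam hn h𝔫 hdom π hW' hμ hT hφ
  obtain ⟨μ, hμ'⟩ := hμ
  have hn1 : 1 ≤ n := le_trans (by norm_num) hn
  have h := exists_basic_of_isLevelFixed (π := π.1) (S := S) (lam := lam) (𝔫 := 𝔫) hn1 hμ' hηZ hfix hne
  obtain ⟨q', η', h1, h2, h3, h4⟩ := h
  exact ⟨S, q', η', h1, h2, h3, h4⟩

end Main

end ConeDictionary

end Literature.NumberTheory.Automorphic
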